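import Literature.Geometry.Lorentzian.TimelikeTubeEnergyFlux
import Literature.Geometry.Lorentzian.KerrConvergence
import HarnessLib

/-!
# Tube luminosity: the Hawking-mass flux through the chart image of a coordinate cylinder

Definition request `defn-TubeLuminosity` (D2) of route `FinalStateConjecture/StarvedNecks`: "the
Hawking-mass energy flux through the chart image of `{rᵢ = R}` between two chart times, as
`TimelikeTube.energyFlux` (`TimelikeTubeEnergyFlux.lean`) of the tube `t ↦ Ψᵢ({t*ᵢ = t, rᵢ = R})`
— the sliding-window functional" (the energy crossing the certified sphere `rᵢ = R₀` of hole `i`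
during `[τ - ρ, τ - R₀]` is a Cauchy difference of Hawking masses of coordinate spheres).

Setting (`KerrConvergence.lean`): a `4`-dimensional spacetime `𝓢`, a reference background
`B : ModelBackground` (domain `U ⊆ E4`, time `t`, radius `r`; for hole `i` of a
`FinalStateDecomposition d`: `d.background i`, boosted Kerr with rest-frame Kerr–Schild time
`t*ᵢ` and radius `rᵢ`) and a chart map `Ψ : U → 𝓢` (`d.chart i`). The level sets
`{t = t₀, r = R} ⊆ U` are the **coordinate spheres** (for the Kerr–Schild radius, `R > 0`: the
confocal ellipsoids `(x² + y²)/(R² + a²) + z²/R² = 1` of the slab `{t* = t₀}`, O'Neill 1995, Ch. 2,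
§2.1), `{r = R}` the coordinate cylinder, `Ψ({r = R})` a world tube of `𝓢`. When that world tube
is a timelike tube foliated by the closed spacelike surfaces `S_t = Ψ({t = t, r = R})`
(Bray–Hayward–Mars–Simon (BHMS), CMP 272 (2007), §2: a flow of spacelike `2`-surfaces with
timelike flow vector; Wang–Yau, PRL 102 (2009) 021101, §2: the timelike boundary `³B` foliated by
`Σ_t`), the energy radiated through it between the cuts `S_{t₁}`, `S_{t₂}` is the Hawking-mass
flux `m_H(S_{t₁}) - m_H(S_{t₂})` of `TimelikeTubeEnergyFlux.lean` (Hayward, PRL 93 (2004) 251101: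
the change `[E]` of the Hawking energy between two surfaces of the hypersurface is the
integrated flux; BHMS Lemma 3) — the luminosity of the coordinate tube integrated over
`[t₁, t₂]` (for cuts receding to `𝓘⁺` along outgoing null hypersurfaces it tends to the
Bondi–Trautman mass loss, Hayward, PRD 49 (1994) 831, §5; `TimelikeTube.tendsto_energyFlux`).

## Main definitions (`namespace Literature.Geometry.Lorentzian`)

* `ModelBackground.coordSphere B R t = {x ∈ U | t(x) = t, r(x) = R}`,
  `ModelBackground.coordTube B R t₁ t₂ = {x ∈ U | t₁ ≤ t(x) ≤ t₂, r(x) = R}`, with their position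
  relative to the slabs / near zones / late regions of `KerrConvergence`, and the sanity lemma
  `Minkowski.image_coordSphere_background` (in Minkowski space: the round spheres `{t} × S²_R`).
* `Spacetime.ChartTube 𝓢 B Ψ R T` — hypothesis structure: a `LorentzianMetric.TimelikeTube` of
  `(𝓢, g, τ)` **adapted to the cylinder `{r = R}` of `Ψ` after time `T`**: for every tube
  parameter `t > T`, `S_t = Ψ({t = t, r = R})` as sets — the tube parameter IS chart time after
  `T`. API: `leaf_mem_image`, `range_leaf_subset_image_truncTimeSlab`, `portion_eq`
  (`𝒯_{[t₁, t₂]} = Ψ({t₁ ≤ t ≤ t₂, r = R})`), `image_map_Ioi_prod`, `mono`.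
* `tubeLuminosity 𝓣 t₁ t₂ = m_H(S_{t₁}) - m_H(S_{t₂})` — **the requested functional**,
  `TimelikeTube.energyFlux` of the adapted tube (`tubeLuminosity_eq_energyFlux`, `rfl`: the whole
  API of `TimelikeTubeEnergyFlux.lean` applies), with `tubeLuminosity_add` (sliding windows
  concatenate), `_symm`, `_nonneg_of_antitoneOn`, `_eq_neg_intervalIntegral` (`= -∫ ṁ_H`) and the
  **starvation lemmas** `tendsto_tubeLuminosity_of_tendsto` (`m_H(S_t) → m` ⇒ the flux over
  windows receding to `+∞` tends to `0`), `tendsto_tubeLuminosity_slidingWindow` (the route's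
  `Φ(τ - ρ(τ), τ - R₀) → 0`), `tendsto_tubeLuminosity_right`, and
  `exists_forall_abs_tubeLuminosity_lt` (Cauchy form).
* `FinalStateDecomposition.HoleTube d i R` — the hole case: tubes adapted to `{rᵢ = R}` of
  `d.chart i` after `d.τ₀`, with `range_leaf_subset_region`, `portion_subset`.

## Mathlib

No Lorentzian geometry, Hawking mass or world tubes in Mathlib (at the pin); used are `Set`
algebra, `Filter.Tendsto`, `Metric.tendsto_atTop`, `abs_sub`, `Metric.sphere`. Everything geometric
is `TimelikeTube` (`TimelikeTubeEnergyFlux`) and `ModelBackground` / `FinalStateDecomposition`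
(`KerrConvergence`); `lean search` for `coordSphere|ChartTube|uminosity` finds only
`AFEnd.isPreconnected_coordSphere` (another object) and `IsLuminosityFoliation` (null cones).

## Design choices

* *Hypothesis structure, not a closed formula.* `hawkingMass` needs compact spacelike immersed
  leaves with a null normal pair, `TimelikeTube` an embedded cylinder with future-timelike flow
  lines. For arbitrary `(Ψ, R)` the world tube `Ψ({r = R})` is none of these; it is when `Ψ^* g`
  is `C¹`-close to boosted Kerr on `{r = R}` with `R` large (on exact Kerr the spheres
  `{t* = t, r = R}`, `R > r₊`, are spacelike — `g = η + 2H ℓ⊗ℓ` is positive on spatial vectors —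
  and `∂_{t*}` is timelike outside the ergoregion), an analytic verification owed by the user, as
  for `TimelikeTube`, `NullHypersurface`, `BondiFoliation`. Statements quantify
  `∀ 𝓣 : 𝓢.ChartTube B Ψ R T, …` (or `∃ 𝓣`); no junk value is produced by a failed side condition.
* *Leaves are pinned as sets* (`range (leaf t) = Ψ '' coordSphere B R t`); the parametrisation by
  `surf` and the null normal pair stay the tube's data. The Hawking mass of a leaf depends on
  neither (reparametrisation invariance of area and `∫ θ_L θ_L̲ dA`; boost/swap invariance of
  `θ_L θ_L̲`, see `TimelikeTubeEnergyFlux`, "the null normal pair is data"), so for `t₁, t₂ > T`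
  the luminosity is a function of `(𝓢, Ψ, R, t₁, t₂)` alone — not formalised (only
  `hawkingMass_swap` is in the tree); `∀ 𝓣`-statements are insensitive to it.
* *Adapted only after `T`, strictly.* `TimelikeTube` is parametrised by all of `ℝ`, while a late
  chart controls its coordinate spheres only on `{t > τ₀}` (`IsLateChart`). Requiring
  `S_t = Ψ({t = t, r = R})` for all `t` would make the structure uninhabitable by honest late
  charts; requiring it for `t > T` costs nothing (precompose chart time with a diffeomorphism
  `ℝ → (T, ∞)` that is the identity on `[T + 1, ∞)` to get a `ChartTube … (T + 1)` from a cylinder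
  that is a timelike tube after `T`). Strict, so that `T = τ₀` (`HoleTube`) never involves the
  boundary slab `{t = τ₀}`. `tubeLuminosity 𝓣 t₁ t₂` with `tᵢ ≤ T` is an honest flux through the
  early, unpinned part of the same tube (additivity holds for all times), not junk.
* *Time orientation.* Flow lines of a `TimelikeTube` are future-directed in the parameter; after
  `T` the parameter is chart time, so chart time increases to the future along an adapted tube.
* *Empty spheres.* If `{t = t, r = R} = ∅` for `t > T` (`R` outside the radius range of `U`),
  only tubes with empty `surf` are adapted; they exist and their luminosity vanishes identically
  (the flux through `∅`). Meant for `R` in the radius range (for `HoleTube`: `R > r₊(Mᵢ, aᵢ)`).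
* *Standing hypothesis.* `[𝓢.metric.HasLeviCivita]` is an instance argument, as for
  `timelikeTubeEnergyFlux` (dischargeable by `PseudoRiemannianMetric.hasLeviCivita`,
  `LeviCivitaProofs.lean`, not imported to keep the sibling's import closure).
* *Not here.* Existence of a `ChartTube`/`HoleTube` for near-Kerr charts; independence of the
  luminosity from the adapted tube; convergence of `m_H(S_t)` from `truncDeviationCk → 0` (what
  feeds `tendsto_tubeLuminosity_of_tendsto` in the route); the flux density (BHMS Lemma 3).

## References

* H. Bray, S. Hayward, M. Mars, W. Simon, Comm. Math. Phys. 272 (2007) 119–138, §2, Lemma 3.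
* S. A. Hayward, Phys. Rev. Lett. 93 (2004) 251101; Phys. Rev. D 49 (1994) 831, §5.
* M.-T. Wang, S.-T. Yau, Phys. Rev. Lett. 102 (2009) 021101, §2.
* S. W. Hawking, J. Math. Phys. 9 (1968) 598 (the Hawking mass).
* M. Dafermos, G. Holzegel, I. Rodnianski, M. Taylor, arXiv:2104.08222, §1 (slabs `{t* = τ}`,
  near zones `{r ≤ R}`).
* B. O'Neill, *The geometry of Kerr black holes*, 1995, Ch. 2, §2.1.
-/

noncomputable section

open Set Filter Function TopologicalSpace
open scoped Topology Manifold ENNReal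

universe u

namespace Literature.Geometry.Lorentzian

/-! ### Coordinate spheres and coordinate tubes of a reference background -/

namespace ModelBackground

/-- The **coordinate sphere** `{x ∈ U | t(x) = t, r(x) = R}` of radius `R` on the slab `{t = t}`
of a reference background — the boundary of the near zone `{t = t, r ≤ R} = truncTimeSlab R t`
(DHRT arXiv:2104.08222, §1); for the Kerr–Schild radius and `R > 0` a confocal ellipsoid
(O'Neill 1995, Ch. 2, §2.1). Empty if `R` is not a value of `r` on `U ∩ {t = t}`. [cite: arXiv210408222, §1] -/
def coordSphere (B : ModelBackground) (R t : ℝ) : Set B.domain :=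
  {x | B.time x.1 = t ∧ B.radius x.1 = R}

/-- The **coordinate tube (portion)** `{x ∈ U | t₁ ≤ t(x) ≤ t₂, r(x) = R}` of the cylinder
`{r = R}` between the slabs `{t = t₁}` and `{t = t₂}` (the union of the coordinate spheres,
`coordTube_eq_iUnion`; empty if `t₂ < t₁`). DHRT arXiv:2104.08222, §1 (the hypersurfaces
`{r = R}` bounding the near region). [cite: arXiv210408222, §1] -/
def coordTube (B : ModelBackground) (R t₁ t₂ : ℝ) : Set B.domain :=
  {x | B.time x.1 ∈ Icc t₁ t₂ ∧ B.radius x.1 = R}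

/-- Membership in a coordinate sphere. [folklore] -/
@[simp]
theorem mem_coordSphere {B : ModelBackground} {R t : ℝ} {x : B.domain} :
    x ∈ B.coordSphere R t ↔ B.time x.1 = t ∧ B.radius x.1 = R :=
  Iff.rfl

/-- Membership in a coordinate tube. [folklore] -/
@[simp]
theorem mem_coordTube {B : ModelBackground} {R t₁ t₂ : ℝ} {x : B.domain} :
    x ∈ B.coordTube R t₁ t₂ ↔ B.time x.1 ∈ Icc t₁ t₂ ∧ B.radius x.1 = R :=
  Iff.rfl

/-- A coordinate sphere lies in its slab `{t = t}`. [folklore] -/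
theorem coordSphere_subset_timeSlab (B : ModelBackground) (R t : ℝ) :
    B.coordSphere R t ⊆ B.timeSlab t :=
  fun _ hx ↦ hx.1

/-- The coordinate sphere of radius `R` lies in the near zone `{t = t, r ≤ R'}`, `R ≤ R'` — the
truncated slab over which `truncDeviationCk … R' t` is measured (DHRT arXiv:2104.08222, §1). [cite: arXiv210408222, §1] -/
theorem coordSphere_subset_truncTimeSlab (B : ModelBackground) {R R' : ℝ} (h : R ≤ R') (t : ℝ) :
    B.coordSphere R t ⊆ B.truncTimeSlab R' t :=
  fun _ hx ↦ ⟨hx.1, hx.2.le.trans h⟩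

/-- Late coordinate spheres lie in the late region `{τ₀ < t}`. [folklore] -/
theorem coordSphere_subset_lateRegion (B : ModelBackground) (R : ℝ) {τ₀ t : ℝ} (h : τ₀ < t) :
    B.coordSphere R t ⊆ B.lateRegion τ₀ :=
  (B.coordSphere_subset_timeSlab R t).trans (B.timeSlab_subset_lateRegion h)

/-- The coordinate spheres `{t = t, r = R}`, `t ∈ [t₁, t₂]`, lie in the coordinate tube. [folklore] -/
theorem coordSphere_subset_coordTube (B : ModelBackground) (R : ℝ) {t t₁ t₂ : ℝ}
    (ht : t ∈ Icc t₁ t₂) : B.coordSphere R t ⊆ B.coordTube R t₁ t₂ :=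
  fun _ hx ↦ ⟨hx.1 ▸ ht, hx.2⟩

/-- The coordinate tube is the union of its coordinate spheres. [folklore] -/
theorem coordTube_eq_iUnion (B : ModelBackground) (R t₁ t₂ : ℝ) :
    B.coordTube R t₁ t₂ = ⋃ t ∈ Icc t₁ t₂, B.coordSphere R t := by
  ext x
  simp only [mem_coordTube, mem_iUnion, mem_coordSphere, exists_prop]
  exact ⟨fun h ↦ ⟨B.time x.1, h.1, rfl, h.2⟩, fun ⟨_, ht, htx, hr⟩ ↦ ⟨htx ▸ ht, hr⟩⟩

/-- Coordinate tubes are monotone in the time interval. [folklore] -/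
theorem coordTube_mono (B : ModelBackground) (R : ℝ) {t₁ t₂ t₁' t₂' : ℝ} (h₁ : t₁' ≤ t₁)
    (h₂ : t₂ ≤ t₂') : B.coordTube R t₁ t₂ ⊆ B.coordTube R t₁' t₂' :=
  fun _ hx ↦ ⟨Icc_subset_Icc h₁ h₂ hx.1, hx.2⟩

/-- A coordinate tube starting after `τ₁` lies in the truncated late region (world tube)
`{τ₁ < t, r ≤ R}` of DHRT arXiv:2104.08222, §1. [cite: arXiv210408222, §1] -/
theorem coordTube_subset_truncLateRegion (B : ModelBackground) (R : ℝ) {τ₁ t₁ : ℝ}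
    (h : τ₁ < t₁) (t₂ : ℝ) : B.coordTube R t₁ t₂ ⊆ B.truncLateRegion τ₁ R :=
  fun _ hx ↦ ⟨h.trans_le hx.1.1, hx.2.le⟩

/-- A coordinate tube starting after `τ₀` lies in the late region `{τ₀ < t}`. [folklore] -/
theorem coordTube_subset_lateRegion (B : ModelBackground) (R : ℝ) {τ₀ t₁ : ℝ} (h : τ₀ < t₁)
    (t₂ : ℝ) : B.coordTube R t₁ t₂ ⊆ B.lateRegion τ₀ :=
  (B.coordTube_subset_truncLateRegion R h t₂).trans (B.truncLateRegion_subset_lateRegion τ₀ R)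

end ModelBackground

/-- Sanity: **the coordinate spheres of Minkowski space are the round spheres** — in the
Minkowski background `(E4, η, t = x⁰, r = |x̲|)` the coordinate sphere `{x⁰ = t, |x̲| = R}` is
`{t} × S²_R`, the image of the Euclidean sphere of radius `R` of `E3` under `y ↦ (t, y)`
(nonempty iff `0 ≤ R`). Christodoulou–Klainerman 1993, Ch. 1. [folklore] -/
theorem Minkowski.image_coordSphere_background (R t : ℝ) :
    Subtype.val '' Minkowski.background.coordSphere R t =
      E4.ofTimeSpace t '' Metric.sphere (0 : E3) R := by
  refine Subset.antisymm ?_ ?_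
  · rintro _ ⟨x, ⟨hxt, hxR⟩, rfl⟩
    refine ⟨E4.spatial x.1, mem_sphere_zero_iff_norm.mpr hxR, ?_⟩
    rw [← E4.ofTimeSpace_time_spatial x.1, E4.time_apply, E4.spatial_ofTimeSpace]
    exact congrArg (E4.ofTimeSpace · (E4.spatial x.1)) hxt.symm
  · rintro _ ⟨y, hy, rfl⟩
    exact ⟨⟨E4.ofTimeSpace t y, trivial⟩,
      ⟨rfl, (E4.spatialNorm_ofTimeSpace t y).trans (mem_sphere_zero_iff_norm.mp hy)⟩, rfl⟩

/-! ### Timelike tubes adapted to a coordinate cylinder of a chart -/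

namespace Spacetime

/-- Hypothesis structure: **a timelike tube of the spacetime `𝓢` adapted to the coordinate
cylinder `{r = R}` of the chart `Ψ : U → 𝓢` (reference background `B`) after time `T`** — a
timelike tube `𝓣 ≅ ℝ × surf` of `(𝓢, g, τ)` in the sense of `LorentzianMetric.TimelikeTube`
(smoothly embedded cylinder foliated by closed spacelike `2`-surfaces `S_t = leaf t (surf)` with
future-directed timelike flow lines and a null normal pair per leaf: the flow of surfaces of
Bray–Hayward–Mars–Simon, CMP 272 (2007), §2; the foliated timelike boundary `³B` of Wang–Yau,
PRL 102 (2009) 021101, §2) whose leaf at every tube parameter `t > T` **is the chart image of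
the coordinate sphere**: `S_t = Ψ({x ∈ U | t(x) = t, r(x) = R})` as subsets of `𝓢`. After `T`
the tube parameter is chart time and the tube is the world tube `Ψ({t > T, r = R})`
(`image_map_Ioi_prod`); before `T` the leaves are unconstrained (a late chart controls its
coordinate spheres only at late times; module docstring). The tube "`t ↦ Ψᵢ({t*ᵢ = t, rᵢ = R})`"
of route `FinalStateConjecture/StarvedNecks` is `FinalStateDecomposition.HoleTube`. Existence is
an analytic property of `(𝓢, Ψ, R)` (true when `Ψ^* g` is `C¹`-close to boosted Kerr on
`{r = R}`, `R` large), owed by the user as for `TimelikeTube` itself. [cite: BrayHaywardMarsSimon2007, §2] -/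
structure ChartTube (𝓢 : Spacetime.{u} 4) (B : ModelBackground) (Ψ : B.domain → 𝓢.carrier)
    (R T : ℝ) extends 𝓢.metric.TimelikeTube 𝓢.timeOrientation where
  /-- After time `T`, the leaf `S_t` is the chart image of the coordinate sphere
  `{t(x) = t, r(x) = R}`. -/
  range_leaf_eq : ∀ t, T < t → range (leaf t) = Ψ '' B.coordSphere R t

namespace ChartTube

variable {𝓢 : Spacetime.{u} 4} {B : ModelBackground} {Ψ : B.domain → 𝓢.carrier} {R T : ℝ}
  (𝓣 : 𝓢.ChartTube B Ψ R T)

/-- After `T`, every point of the leaf `S_t` is the chart image of a point of the coordinate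
sphere `{t = t, r = R}`. [folklore] -/
theorem leaf_mem_image {t : ℝ} (ht : T < t) (y : 𝓣.surf) :
    𝓣.leaf t y ∈ Ψ '' B.coordSphere R t := by
  rw [← 𝓣.range_leaf_eq t ht]
  exact mem_range_self y

/-- After `T`, the chart image of the coordinate sphere consists of points of the leaf `S_t`.
[folklore] -/
theorem image_coordSphere_subset_range {t : ℝ} (ht : T < t) :
    Ψ '' B.coordSphere R t ⊆ range (𝓣.leaf t) :=
  (𝓣.range_leaf_eq t ht).ge

/-- After `T`, the leaf `S_t` lies in the chart image of the slab `{t = t}`. [folklore] -/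
theorem range_leaf_subset_image_timeSlab {t : ℝ} (ht : T < t) :
    range (𝓣.leaf t) ⊆ Ψ '' B.timeSlab t :=
  (𝓣.range_leaf_eq t ht).trans_subset (image_mono (B.coordSphere_subset_timeSlab R t))

/-- After `T`, the leaf `S_t` lies in the chart image of the near zone `{t = t, r ≤ R'}`,
`R ≤ R'` — the truncated slab of `truncDeviationCk … R' t` (DHRT arXiv:2104.08222, §1). [cite: arXiv210408222, §1] -/
theorem range_leaf_subset_image_truncTimeSlab {t : ℝ} (ht : T < t) {R' : ℝ} (hR : R ≤ R') :
    range (𝓣.leaf t) ⊆ Ψ '' B.truncTimeSlab R' t :=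
  (𝓣.range_leaf_eq t ht).trans_subset (image_mono (B.coordSphere_subset_truncTimeSlab hR t))

/-- After `T`, the leaf `S_t` lies in the chart image of the late region `{τ₀ < t}`, `τ₀ ≤ T`.
[folklore] -/
theorem range_leaf_subset_image_lateRegion {t : ℝ} (ht : T < t) {τ₀ : ℝ} (hτ : τ₀ ≤ T) :
    range (𝓣.leaf t) ⊆ Ψ '' B.lateRegion τ₀ :=
  (𝓣.range_leaf_eq t ht).trans_subset
    (image_mono (B.coordSphere_subset_lateRegion R (hτ.trans_lt ht)))

/-- **The tube portion between two late cuts is the chart image of the coordinate tube**: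
`𝒯_{[t₁, t₂]} = Ψ({t₁ ≤ t ≤ t₂, r = R})` for `T < t₁` (both sides empty if `t₂ < t₁`).
Wang–Yau, PRL 102 (2009) 021101, §2 (`³B` between `Σ_{t'}` and `Σ_{t''}`). [cite: WangYau2009PRL, §2] -/
theorem portion_eq {t₁ : ℝ} (ht : T < t₁) (t₂ : ℝ) :
    𝓣.portion t₁ t₂ = Ψ '' B.coordTube R t₁ t₂ := by
  refine Subset.antisymm ?_ ?_
  · rintro _ ⟨⟨t, y⟩, ⟨hty, -⟩, rfl⟩
    obtain ⟨x, hx, hxy⟩ := 𝓣.leaf_mem_image (ht.trans_le hty.1) y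
    exact ⟨x, B.coordSphere_subset_coordTube R hty hx, hxy⟩
  · rintro _ ⟨x, ⟨htx, hrx⟩, rfl⟩
    obtain ⟨y, hy⟩ : Ψ x ∈ range (𝓣.leaf (B.time x.1)) := by
      rw [𝓣.range_leaf_eq _ (ht.trans_le htx.1)]
      exact ⟨x, ⟨rfl, hrx⟩, rfl⟩
    exact ⟨(B.time x.1, y), ⟨htx, mem_univ _⟩, hy⟩

/-- **After `T` the tube is the world tube of the coordinate cylinder**:
`F((T, ∞) × surf) = Ψ({T < t, r = R})`. [folklore] -/
theorem image_map_Ioi_prod :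
    𝓣.map '' (Ioi T ×ˢ univ) = Ψ '' {x | T < B.time x.1 ∧ B.radius x.1 = R} := by
  refine Subset.antisymm ?_ ?_
  · rintro _ ⟨⟨t, y⟩, ⟨hty, -⟩, rfl⟩
    obtain ⟨x, hx, hxy⟩ := 𝓣.leaf_mem_image (mem_Ioi.mp hty) y
    exact ⟨x, ⟨hx.1 ▸ mem_Ioi.mp hty, hx.2⟩, hxy⟩
  · rintro _ ⟨x, ⟨htx, hrx⟩, rfl⟩
    obtain ⟨y, hy⟩ : Ψ x ∈ range (𝓣.leaf (B.time x.1)) := by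
      rw [𝓣.range_leaf_eq _ htx]
      exact ⟨x, ⟨rfl, hrx⟩, rfl⟩
    exact ⟨(B.time x.1, y), ⟨mem_Ioi.mpr htx, mem_univ _⟩, hy⟩

/-- After `T`, the portion between two cuts lies in the chart image of the late region
`{τ₀ < t}`, `τ₀ ≤ T`. [folklore] -/
theorem portion_subset_image_lateRegion {t₁ : ℝ} (ht : T < t₁) (t₂ : ℝ) {τ₀ : ℝ} (hτ : τ₀ ≤ T) :
    𝓣.portion t₁ t₂ ⊆ Ψ '' B.lateRegion τ₀ :=
  (𝓣.portion_eq ht t₂).trans_subset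
    (image_mono (B.coordTube_subset_lateRegion R (hτ.trans_lt ht) t₂))

/-- A tube adapted to the coordinate cylinder after `T` is adapted after every `T' ≥ T` (same
tube). [folklore] -/
def mono {T' : ℝ} (h : T ≤ T') : 𝓢.ChartTube B Ψ R T' where
  toTimelikeTube := 𝓣.toTimelikeTube
  range_leaf_eq t ht := 𝓣.range_leaf_eq t (h.trans_lt ht)

/-- `mono` does not change the underlying timelike tube. [folklore] -/
@[simp]
theorem toTimelikeTube_mono {T' : ℝ} (h : T ≤ T') :
    (𝓣.mono h).toTimelikeTube = 𝓣.toTimelikeTube :=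
  rfl

end ChartTube

end Spacetime

/-! ### The luminosity of a coordinate tube -/

section Luminosity

variable {𝓢 : Spacetime.{u} 4} [𝓢.metric.HasLeviCivita] {B : ModelBackground}
  {Ψ : B.domain → 𝓢.carrier} {R T : ℝ}

/-- **Tube luminosity** (definition request `TubeLuminosity` of route
`FinalStateConjecture/StarvedNecks`): the Hawking-mass energy flux `m_H(S_{t₁}) - m_H(S_{t₂})`
through the world tube `Ψ({t₁ ≤ t ≤ t₂, r = R})` — the chart image of the coordinate cylinder
`{r = R}` between the chart times `t₁` and `t₂` (`ChartTube.portion_eq`) — of a timelike tube `𝓣`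
of `𝓢` adapted to that cylinder, i.e. `TimelikeTube.energyFlux` of `𝓣`
(`tubeLuminosity_eq_energyFlux`, `rfl`): the net quasi-local (Hawking) energy radiated outward
through `{r = R}` during `[t₁, t₂]`, the time-integrated luminosity of the coordinate tube
(Hayward, PRL 93 (2004) 251101: `[E] = ∫_H (T + Θ) d²A dx`; density Bray–Hayward–Mars–Simon 2007,
Lemma 3; for cuts receding to `𝓘⁺` it tends to the Bondi–Trautman mass loss,
`TimelikeTube.tendsto_energyFlux`). Meaningful for `T < t₁, t₂`; the sliding-window functional of
the route is `tubeLuminosity 𝓣 (τ - ρ) (τ - R₀)`. Unsigned in general; `≥ 0` when `m_H(S_t)` is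
non-increasing (`tubeLuminosity_nonneg_of_antitoneOn`); `→ 0` over receding windows when
`m_H(S_t)` converges (`tendsto_tubeLuminosity_of_tendsto`). [cite: Hayward2004, integral forms of the first law] -/
def tubeLuminosity (𝓣 : 𝓢.ChartTube B Ψ R T) (t₁ t₂ : ℝ) : ℝ :=
  𝓣.energyFlux t₁ t₂

variable (𝓣 : 𝓢.ChartTube B Ψ R T)

/-- Unfolding lemma: `tubeLuminosity 𝓣 t₁ t₂ = m_H(S_{t₁}) - m_H(S_{t₂})`. [folklore] -/
theorem tubeLuminosity_eq (t₁ t₂ : ℝ) :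
    tubeLuminosity 𝓣 t₁ t₂ = 𝓣.leafHawkingMass t₁ - 𝓣.leafHawkingMass t₂ :=
  rfl

/-- The tube luminosity is the Hawking-mass flux `TimelikeTube.energyFlux` of the adapted tube
(so the API of `TimelikeTubeEnergyFlux.lean` applies verbatim). [folklore] -/
theorem tubeLuminosity_eq_energyFlux (t₁ t₂ : ℝ) : tubeLuminosity 𝓣 t₁ t₂ = 𝓣.energyFlux t₁ t₂ :=
  rfl

/-- The tube luminosity is `timelikeTubeEnergyFlux` (the `Spacetime 4` form) of the underlying
timelike tube. [folklore] -/
theorem tubeLuminosity_eq_timelikeTubeEnergyFlux (t₁ t₂ : ℝ) :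
    tubeLuminosity 𝓣 t₁ t₂ = timelikeTubeEnergyFlux 𝓢 𝓣.toTimelikeTube t₁ t₂ :=
  rfl

/-- No energy crosses the cylinder during a window of zero duration. [folklore] -/
@[simp]
theorem tubeLuminosity_self (t : ℝ) : tubeLuminosity 𝓣 t t = 0 :=
  𝓣.energyFlux_self t

/-- **Additivity over consecutive windows** (sliding windows concatenate):
`Φ(t₁, t₂) + Φ(t₂, t₃) = Φ(t₁, t₃)`. Hayward 2004 (integral form of the first law). [folklore] -/
@[simp]
theorem tubeLuminosity_add (t₁ t₂ t₃ : ℝ) :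
    tubeLuminosity 𝓣 t₁ t₂ + tubeLuminosity 𝓣 t₂ t₃ = tubeLuminosity 𝓣 t₁ t₃ :=
  𝓣.energyFlux_add_energyFlux t₁ t₂ t₃

/-- Reversing the window reverses the sign. [folklore] -/
theorem tubeLuminosity_symm (t₁ t₂ : ℝ) : tubeLuminosity 𝓣 t₂ t₁ = -tubeLuminosity 𝓣 t₁ t₂ :=
  𝓣.energyFlux_symm t₁ t₂

/-- **The radiated energy is a Cauchy difference of Hawking masses**:
`m_H(S_{t₂}) - m_H(S_{t₁}) = -Φ(t₁, t₂)` (Hayward, PRL 93 (2004) 251101, `[E]`). [cite: Hayward2004, integral forms of the first law] -/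
theorem leafHawkingMass_sub_eq_neg_tubeLuminosity (t₁ t₂ : ℝ) :
    𝓣.leafHawkingMass t₂ - 𝓣.leafHawkingMass t₁ = -tubeLuminosity 𝓣 t₁ t₂ :=
  𝓣.leafHawkingMass_sub_eq_neg_energyFlux t₁ t₂

/-- `Φ(t₁, t₂) = -∫_{t₁}^{t₂} ṁ_H`: the time-integrated luminosity is minus the integral of the
rate of change of the Hawking mass of the coordinate spheres (FTC; the integrand is
Bray–Hayward–Mars–Simon 2007, Lemma 3). [cite: BrayHaywardMarsSimon2007, Lemma 3] -/
theorem tubeLuminosity_eq_neg_intervalIntegral {t₁ t₂ : ℝ} (m' : ℝ → ℝ)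
    (hderiv : ∀ t ∈ uIcc t₁ t₂, HasDerivAt 𝓣.leafHawkingMass (m' t) t)
    (hint : IntervalIntegrable m' MeasureTheory.volume t₁ t₂) :
    tubeLuminosity 𝓣 t₁ t₂ = -∫ t in t₁..t₂, m' t :=
  𝓣.energyFlux_eq_neg_intervalIntegral m' hderiv hint

/-- The energy radiated through the cylinder is nonnegative iff the Hawking mass of the
coordinate spheres has not increased. [folklore] -/
theorem tubeLuminosity_nonneg_iff (t₁ t₂ : ℝ) :
    0 ≤ tubeLuminosity 𝓣 t₁ t₂ ↔ 𝓣.leafHawkingMass t₂ ≤ 𝓣.leafHawkingMass t₁ :=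
  𝓣.energyFlux_nonneg_iff t₁ t₂

/-- **Mass loss**: if the Hawking mass of the coordinate spheres is non-increasing on `[t₁, t₂]`,
the energy radiated through `{r = R}` during `[t₁, t₂]` is nonnegative (hypothesis form of
Bray–Hayward–Mars–Simon 2007, Thm 1, and of Bondi mass loss). [cite: BrayHaywardMarsSimon2007, Thm 1] -/
theorem tubeLuminosity_nonneg_of_antitoneOn {t₁ t₂ : ℝ} (ht : t₁ ≤ t₂)
    (h : AntitoneOn 𝓣.leafHawkingMass (Icc t₁ t₂)) : 0 ≤ tubeLuminosity 𝓣 t₁ t₂ :=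
  𝓣.energyFlux_nonneg_of_antitoneOn ht h

/-- **Starvation of receding windows.** If the Hawking masses of the coordinate spheres converge,
`m_H(S_t) → m` as `t → ∞` (e.g. from convergence of `Ψ^* g` to boosted Kerr on the near zones
`{t = t, r ≤ R}`), the energy radiated through `{r = R}` during windows `[a i, b i]` whose ends
both recede to `+∞` tends to `0` — the sliding-window budget `Φ(τ - ρ(τ), τ - R₀) → 0` of route
`FinalStateConjecture/StarvedNecks` (a Cauchy difference of a convergent function). [folklore] -/
theorem tendsto_tubeLuminosity_of_tendsto {m : ℝ} (h : Tendsto 𝓣.leafHawkingMass atTop (𝓝 m))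
    {ι : Type*} {l : Filter ι} {a b : ι → ℝ} (ha : Tendsto a l atTop) (hb : Tendsto b l atTop) :
    Tendsto (fun i ↦ tubeLuminosity 𝓣 (a i) (b i)) l (𝓝 0) := by
  have hab := (h.comp ha).sub (h.comp hb)
  rw [sub_self] at hab
  exact hab

/-- **The sliding window of route `FinalStateConjecture/StarvedNecks`, literally**: if
`m_H(S_t) → m` then `Φ(τ - ρ(τ), τ - R₀) → 0` as `τ → ∞` for every window profile `ρ` with
`τ - ρ(τ) → ∞` and every `R₀`. [folklore] -/
theorem tendsto_tubeLuminosity_slidingWindow {m : ℝ} (h : Tendsto 𝓣.leafHawkingMass atTop (𝓝 m))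
    {ρ : ℝ → ℝ} (hρ : Tendsto (fun τ ↦ τ - ρ τ) atTop atTop) (R₀ : ℝ) :
    Tendsto (fun τ ↦ tubeLuminosity 𝓣 (τ - ρ τ) (τ - R₀)) atTop (𝓝 0) :=
  tendsto_tubeLuminosity_of_tendsto 𝓣 h hρ
    (tendsto_atTop_atTop.mpr fun b ↦ ⟨b + R₀, fun τ hτ ↦ by linarith⟩)

/-- **Total energy radiated after `t₁`**: if `m_H(S_t) → m` then `Φ(t₁, t) → m_H(S_{t₁}) - m`
as `t → ∞`. [folklore] -/
theorem tendsto_tubeLuminosity_right {m : ℝ} (h : Tendsto 𝓣.leafHawkingMass atTop (𝓝 m))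
    (t₁ : ℝ) : Tendsto (fun t ↦ tubeLuminosity 𝓣 t₁ t) atTop (𝓝 (𝓣.leafHawkingMass t₁ - m)) :=
  tendsto_const_nhds.sub h

/-- **Starvation, uniform (Cauchy) form.** If `m_H(S_t) → m` as `t → ∞`, then for every `ε > 0`
there is `T₀` such that the energy radiated through `{r = R}` during any window with both ends
after `T₀` has absolute value `< ε`. [folklore] -/
theorem exists_forall_abs_tubeLuminosity_lt {m : ℝ} (h : Tendsto 𝓣.leafHawkingMass atTop (𝓝 m))
    {ε : ℝ} (hε : 0 < ε) :
    ∃ T₀ : ℝ, ∀ t₁ t₂, T₀ ≤ t₁ → T₀ ≤ t₂ → |tubeLuminosity 𝓣 t₁ t₂| < ε := by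
  obtain ⟨T₀, hT₀⟩ := Metric.tendsto_atTop.mp h (ε / 2) (half_pos hε)
  refine ⟨T₀, fun t₁ t₂ h₁ h₂ ↦ ?_⟩
  have e₁ := hT₀ t₁ h₁
  have e₂ := hT₀ t₂ h₂
  rw [Real.dist_eq] at e₁ e₂
  rw [tubeLuminosity_eq,
    show 𝓣.leafHawkingMass t₁ - 𝓣.leafHawkingMass t₂ =
      (𝓣.leafHawkingMass t₁ - m) - (𝓣.leafHawkingMass t₂ - m) by ring]
  exact (abs_sub _ _).trans_lt (by linarith)

end Luminosity

/-! ### The coordinate tubes of the holes of a final state decomposition -/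

namespace FinalStateDecomposition

variable {𝓢 : Spacetime.{u} 4} {𝒟 : Set 𝓢.carrier} {k : ℕ}

/-- **The coordinate tubes of hole `i` at rest-frame Kerr–Schild radius `R`** of an
`N`-black-hole final state decomposition `d` (the tube "`t ↦ Ψᵢ({t*ᵢ = t, rᵢ = R})`" of route
`FinalStateConjecture/StarvedNecks`): timelike tubes of `𝓢` adapted, after the common late time
`τ₀`, to the cylinder `{rᵢ = R}` of the hole chart `d.chart i` on the boosted Kerr background
`d.background i` (`Spacetime.ChartTube`); their luminosity is `tubeLuminosity`. Meant for
`R > r₊(Mᵢ, aᵢ)`. Final state folklore (Klainerman, *Brief history of the black hole stability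
problem*, §4); near zones `{r ≤ R}`: DHRT arXiv:2104.08222, §1. [folklore] -/
abbrev HoleTube (d : FinalStateDecomposition 𝓢 𝒟 k) (i : Fin d.N) (R : ℝ) :=
  𝓢.ChartTube (d.background i) (d.chart i) R d.τ₀

namespace HoleTube

variable {d : FinalStateDecomposition 𝓢 𝒟 k} {i : Fin d.N} {R : ℝ} (𝓣 : d.HoleTube i R)

/-- The late leaves of a hole tube lie in the black-hole region `Ψᵢ({t*ᵢ > τ₀})` of hole `i`.
[folklore] -/
theorem range_leaf_subset_region {t : ℝ} (ht : d.τ₀ < t) : range (𝓣.leaf t) ⊆ d.region i :=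
  𝓣.range_leaf_subset_image_lateRegion ht le_rfl

/-- The late leaves of a hole tube lie in the region `𝒟` being decomposed. [folklore] -/
theorem range_leaf_subset {t : ℝ} (ht : d.τ₀ < t) : range (𝓣.leaf t) ⊆ 𝒟 :=
  (𝓣.range_leaf_subset_region ht).trans (d.region_subset i)

/-- The late portions of a hole tube lie in the black-hole region of hole `i`. [folklore] -/
theorem portion_subset_region {t₁ : ℝ} (ht : d.τ₀ < t₁) (t₂ : ℝ) :
    𝓣.portion t₁ t₂ ⊆ d.region i :=
  𝓣.portion_subset_image_lateRegion ht t₂ le_rfl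

/-- The late portions of a hole tube lie in the region `𝒟` being decomposed. [folklore] -/
theorem portion_subset {t₁ : ℝ} (ht : d.τ₀ < t₁) (t₂ : ℝ) : 𝓣.portion t₁ t₂ ⊆ 𝒟 :=
  (𝓣.portion_subset_region ht t₂).trans (d.region_subset i)

end HoleTube

end FinalStateDecomposition

end Literature.Geometry.Lorentzian

end
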